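import Summits.QuantumFields.BalabanUV.T4Continuum.Support.VariationalCovariantUpperBound
import Summits.QuantumFields.BalabanUV.T4Continuum.Support.VariationalColourFederbush

/-!
# T⁴ programme, spine node NE2 (U1a), lane P2 — SUPPLIER LEAF V-COL-UB: the COLOUR ∕ VECTOR-VALUED re-run of leaf UB⁺
# (`VariationalCovariantUpperBound`, p212172) — a k-UNIFORM UPPER BOUND for the covariant effective Dirichlet action of fields with values in ANY
# normed ℂ-space `E`, transported by contractive linear maps, by the SAME explicit local competitor — every torus, every level, model level

NE2 formalisation swarm `b2b-balaban-t4-ne2-formalise-*`, leaf 03 GEN 4 (`prover-b2b-balaban-t4-ne2-formalise-leaf-03-g4-0`), acting as a SUPPLIER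
SEAT for item (O8) «V-COL» of the P2 (variational) skeleton `t4/skeletons/NE2-t4-ne2-p2.md` v0.10 §2.E ∕ §7 («V-COL = the COLOUR (adjoint ∕ matrix) re-run
of §2.C's FED⁺ ∕ UB⁺ ∕ ONE⁺ ∕ P⁺ ∕ REG⁺ for M_o(ℂ)-valued 0-forms under transport by unitary matrices … prerequisite of everything below»), member UB⁺;
journal INTENT CLAIMS.log l.10560.  CARRIERS BY NAME from the FED⁺ member of V-COL, leaf-02-g4's `VariationalColourFederbush` (p214930): `E`-valued fields,
transporters = continuous linear maps `E →L[ℂ] E` of operator norm ≤ 1, `Qcv n M T f` (the transported block average, [B9] (3.19) SHAPE) and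
`dirUv (fine n M) R f μ` (the covariant Dirichlet sum per direction, (3.3) SHAPE) — ONE colour carrier family; at `E = ℂ` they ARE the scalar leaves' `Qc`∕`dirU`
(`Qcv_phase`, `dirUv_phase` there).  Imports the scalar leaf UB⁺ for `inv_beta_pow_mem` and leaf-09's `ScalarBlockTrialFunction` weights BY NAME.

HONEST FRAMING (T4-DAG p. 1).  Rung (B)+1 only — NOT infinite volume, NOT a mass gap, NOT Clay.  Node NE2 is NOT IN PRINT and NOT proved here.
MODEL LEVEL: the site transports `T(x) : E →L[ℂ] E` with right inverses `S(x)` and the bond transporters `R(x,μ) : E →L[ℂ] E` are DATA (no group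
structure, no identification with Bałaban's `U(Γ^{(j)}_{y,x})`, `U_k(V)` — P2 §4(b) ∕ P1 c5); lattice units; 0-form sector with values in `E`.  What is proved
is OURS and elementary ([folklore] lattice calculus, one triangle inequality per bond); nothing printed is a hypothesis; data `def`s `nsqv`, `trialv`,
`comp` only, no `def … : Prop`, no `sorry`; axioms standard.  HONEST DEPENDENCY (cell, verbatim):
continuum YM on T⁴ ⇐ BetaPertH ∧ nine spine estimates (0/9 proved); BetaPertH ⇐ (D1) ∧ (D4) ∧ CAP+tail; G-an2-4 gates asym, D1 and NE2/3/4.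

THE STATEMENT (leaf UB⁺ of §2.C, re-run for `E`-valued fields; the scalar file's docstring applies word for word with `conj T ↦ S`, `|·| ↦ ‖·‖_E ∕ ‖·‖_op`).
Level `n = L^k`, torus `Tor (fine n M)` over the unit torus `Tor M`, blocks `B(y) = {bpt n M y j}`; `E` any normed ℂ-space (`ℂ` = the scalar leaf;
`EuclideanSpace ℂ o` = colour vectors; `Matrix o o ℂ` with any submultiplicative-compatible norm = the adjoint∕`siteMul` reading — the file never chooses).
HYPOTHESES (all ONE-LEVEL, all about the transporters): `T(x)∘S(x) = 1` (right inverse — so the constraint fibre is met exactly), `‖T(x)‖ ≤ 1`, `‖S(x)‖ ≤ 1`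
(isometric equivalences `U(x) : E ≃ₗᵢ[ℂ] E`: `S = U⁻¹`; unit phases: `S = conj t • 1` — both in the sequel `…Data`), `‖R(x,μ)‖ ≤ 1`, and the IN-BLOCK defect

  `‖R(x,μ) ∘ S(x+e_μ) ∘ T(x) − 1‖_op ≤ w`   for every bond `(x, x+e_μ)` with BOTH ends in the same block                                   (hw)

(NO hypothesis relates transports of DIFFERENT blocks — no global frame, no global small field).  CONCLUSION: for every unit-lattice field `φ : Tor M → E`
the EXPLICIT competitor

  `λ_φ(x) := S(x)((β₁^d)⁻¹ • ψ_φ(x))`,   `ψ_φ(n·y+j) = W(j) • φ(y)`, `W(j) = Π_ν b(j_ν)`, `b(t) = (t+1)(n−t)/n²` (leaf-09's `ScalarBlockTrialFunction` weights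
  BY NAME: block means `β₁^d`, `β₁ ≥ 1/6`, face values `W ≤ 1/n`, steps `|n·Δb| ≤ 1`)

satisfies the constraint EXACTLY, `Qcv n M T λ_φ = φ` (`Qcv_comp`), and

  `n²·Σ_μ dirUv R λ_φ μ ≤ 2d·(β₁^d)⁻²·((1 + n·w)² + 9)·n^d·Σ_y‖φ(y)‖²`                                      (`sq_mul_dirUv_comp_le`),

i.e. in physical units `Sc(λ_φ) ≤ 2d·36^d·((1 + n w)² + 9)·‖φ‖²` (`physDirv_comp_le`); hence for P2's type-generic `VariationalTransfer.blockSpin`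

  `Δ′(φ) := blockSpin (Qcv n M T) Sc φ ≤ 2d·36^d·((1 + n w)² + 9)·Σ_y‖φ y‖²`                              (`blockSpin_colour_le`)

and the `∃`-form `exists_ubv_phys` — the SAME constants as the scalar leaf, uniform in `n`, the torus, `E` and the background class.  THE ONE ALGEBRAIC POINT
(§3, `cov_diff_split`): `R(S(x′)g(x′)) − S(x)g(x) = S(x)(g x′ − g x) + (R∘S(x′)∘T(x) − 1)(S(x) g x′)` uses ONLY `T(x)∘S(x) = 1` — no commutativity, so the scalar
proof ports verbatim (in-block bonds pay `w` on `‖ψ_φ‖ ≤ ‖φ(y)‖`, face bonds pay `‖R∘S∘T − 1‖ ≤ 2` on the face value `‖φ‖/n`).  The sequel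
`Support/VariationalColourUpperBoundData` carries the block form of (hw), the lattice-units `∃`-form, and DISCHARGES the three transport binders for isometric
site transports `E ≃ₗᵢ[ℂ] E` and for unit phases `t • 1` (at `E = ℂ`: the scalar leaf's carriers and theorem, letter for letter).
NOT CLAIMED: the bound `w ≲ d·n·a` for contour transports built from matrix-valued bond variables (the colour twin of leaf-04-g2's `VariationalTaxiTransport`;
ordered products — a separate geometric leaf), the unitary-MATRIX-to-`≃ₗᵢ` dictionary on `EuclideanSpace ℂ o` (Mathlib's `Matrix.toEuclideanCLM`; the
consumer's one-liner once the road owner fixes the colour carrier), the other V-COL members (ONE⁺ ∕ P⁺ ∕ REG⁺-colour), the 1-form leaves V-UB ∕ V-FED ∕ …,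
multi-region ∕ Dirichlet versions ([B9]'s setting).  NE2 NOT proved; spine 0/9 unchanged.
-/

noncomputable section

namespace Summit.QuantumFields.BalabanUV.T4Continuum.VariationalColourUpperBound

open Finset
open scoped ComplexConjugate Matrix
open Literature.MathematicalPhysics.QuantumFieldTheory.Balaban1983to89
open Literature.MathematicalPhysics.QuantumFieldTheory.Balaban1983to89.B5Prop11Plancherel (Tor fine unitVec)
open Literature.MathematicalPhysics.QuantumFieldTheory.Balaban1983to89.B5Block118 (bpt)
open Literature.MathematicalPhysics.QuantumFieldTheory.Balaban1983to89.B5AverageCurlStokes (sum_blocks_real)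
open Literature.MathematicalPhysics.QuantumFieldTheory.Balaban1983to89.B5Blocks16 (blockOf blockOf_bpt)
open Summit.QuantumFields.BalabanUV.T4Continuum.ScalarBlockTrialFunction
  (digits digits_bpt bump bump_mem bump_face abs_bump_step_le beta1 beta1_ge bumpW bumpW_mem bumpW_update prod_erase_mem sum_bumpW_eq
   bpt_add_unitVec_of_lt bpt_add_unitVec_of_eq)
open Summit.QuantumFields.BalabanUV.T4Continuum.VariationalTransfer (blockSpin blockSpin_le)
open Summit.QuantumFields.BalabanUV.T4Continuum.VariationalCovariantUpperBound (inv_beta_pow_mem)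
open Summit.QuantumFields.BalabanUV.T4Continuum.VariationalColourFederbush (Qcv cDv dirUv dirUv_nonneg)

variable {d : ℕ} (n : ℕ) [NeZero n] (M : Fin d → ℕ) [hM : ∀ μ, NeZero (M μ)]
variable {E : Type*} [NormedAddCommGroup E]

/-! ## §1 The carriers: leaf-02-g4's `E`-valued `Qcv` (transported block average) and `dirUv` (covariant Dirichlet sum per direction) BY NAME; the `ℓ²` size -/

/-- the unit-lattice `ℓ²` size `Σ_y ‖φ y‖²` of an `E`-valued field (at `E = ℂ` literally `B5Prop11Lower.nsq`). [folklore] -/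
def nsqv {ι : Type*} [Fintype ι] (φ : ι → E) : ℝ := ∑ i, ‖φ i‖ ^ 2

/-- `0 ≤ Σ‖φ‖²`. [folklore] -/
theorem nsqv_nonneg {ι : Type*} [Fintype ι] (φ : ι → E) : 0 ≤ nsqv φ := sum_nonneg fun _ _ => by positivity

variable [NormedSpace ℂ E]

/-! ## §2 The `E`-valued trial function `ψ_φ(n·y+j) = W(j) • φ(y)` (leaf-09's in-block bump weights `W = Π_ν b(j_ν)` BY NAME) -/

/-- **the trial function** `ψ_φ(x) = W(digits x) • φ(block x)` — `ScalarBlockTrialFunction.trial` with `E`-valued data. [folklore] -/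
def trialv (φ : Tor M → E) : Tor (fine n M) → E := fun x => ((bumpW n (digits n M x) : ℝ) : ℂ) • φ (blockOf n M x)

/-- `ψ_φ(n·y + j) = W(j) • φ(y)`. [folklore] -/
theorem trialv_bpt (φ : Tor M → E) (y : Tor M) (j : Fin d → Fin n) :
    trialv n M φ (bpt n M y j) = ((bumpW n j : ℝ) : ℂ) • φ y := by
  rw [trialv, blockOf_bpt, digits_bpt]

/-- block sums of the trial function: `Σ_j ψ_φ(n·y+j) = (n·β₁)^d • φ(y)` (`sum_bumpW_eq`). [folklore] -/
theorem sum_trialv_eq (φ : Tor M → E) (y : Tor M) :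
    ∑ j : Fin d → Fin n, trialv n M φ (bpt n M y j) = ((((n : ℝ) * beta1 n) ^ d : ℝ) : ℂ) • φ y := by
  simp only [trialv_bpt]
  rw [← Finset.sum_smul, ← Complex.ofReal_sum, sum_bumpW_eq n]

/-- the trial function's values: `‖ψ_φ(n·y+j)‖ ≤ ‖φ(y)‖` everywhere and `‖ψ_φ(n·y+j[μ↦0])‖ ≤ ‖φ(y)‖/n` on the entry face. [folklore] -/
theorem norm_trialv_le (φ : Tor M → E) (y : Tor M) (j : Fin d → Fin n) (μ : Fin d) :
    ‖trialv n M φ (bpt n M y j)‖ ≤ ‖φ y‖ ∧ ‖trialv n M φ (bpt n M y (Function.update j μ 0))‖ ≤ ‖φ y‖ / n := by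
  have hn0 : (0 : ℝ) < n := by exact_mod_cast Nat.pos_of_ne_zero (NeZero.ne n)
  constructor
  · rw [trialv_bpt, norm_smul, Complex.norm_real, Real.norm_of_nonneg (bumpW_mem n j).1]
    exact mul_le_of_le_one_left (norm_nonneg _) (bumpW_mem n j).2
  · obtain ⟨hR0, hR1⟩ := prod_erase_mem n j μ
    have hW : bumpW n (Function.update j μ 0) = bump n ((0 : Fin n) : ℕ) * ∏ ν ∈ Finset.univ.erase μ, bump n (j ν) :=
      (bumpW_update n j μ 0).1
    have hface : bump n ((0 : Fin n) : ℕ) = 1 / n := by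
      have hpred : (n - 1) + 1 = n := Nat.sub_add_cancel (Nat.pos_of_ne_zero (NeZero.ne n))
      rw [Fin.val_zero]; exact (bump_face n (n - 1) hpred).2
    rw [trialv_bpt, norm_smul, Complex.norm_real, hW, hface, Real.norm_of_nonneg (by positivity)]
    have h1 : 1 / (n : ℝ) * ∏ ν ∈ Finset.univ.erase μ, bump n (j ν) ≤ 1 / (n : ℝ) :=
      mul_le_of_le_one_right (by positivity) hR1
    calc 1 / (n : ℝ) * (∏ ν ∈ Finset.univ.erase μ, bump n (j ν)) * ‖φ y‖ ≤ 1 / (n : ℝ) * ‖φ y‖ :=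
          mul_le_mul_of_nonneg_right h1 (norm_nonneg _)
      _ = ‖φ y‖ / n := by ring

/-- the one-step differences of `ψ_φ`: `‖n • (ψ_φ(x + e_ν) − ψ_φ(x))‖ ≤ ‖φ(y)‖ + ‖φ(y + e_ν)‖` at `x = n·y + j` — inside the block the weight moves by
`≤ 1/n` (`abs_bump_step_le`), across a face both values are `(1/n)·Π_{μ≠ν}b • φ`. [folklore] -/
theorem norm_step_trialv_le (φ : Tor M → E) (y : Tor M) (j : Fin d → Fin n) (ν : Fin d) :
    ‖(n : ℂ) • (trialv n M φ (bpt n M y j + unitVec (fine n M) ν) - trialv n M φ (bpt n M y j))‖ ≤ ‖φ y‖ + ‖φ (y + unitVec M ν)‖ := by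
  set R : ℝ := ∏ μ ∈ Finset.univ.erase ν, bump n (j μ) with hR
  have hR0 : 0 ≤ R := (prod_erase_mem n j ν).1
  have hR1 : R ≤ 1 := (prod_erase_mem n j ν).2
  have hW : bumpW n j = bump n (j ν) * R := (bumpW_update n j ν 0).2
  by_cases h : (j ν : ℕ) + 1 < n
  · -- inside the block
    have hW' : bumpW n (Function.update j ν ⟨(j ν : ℕ) + 1, h⟩) = bump n ((j ν : ℕ) + 1) * R := (bumpW_update n j ν _).1
    rw [bpt_add_unitVec_of_lt n M y j ν h, trialv_bpt, trialv_bpt, hW', hW, ← sub_smul, smul_smul]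
    have e : (n : ℂ) * (((bump n ((j ν : ℕ) + 1) * R : ℝ) : ℂ) - ((bump n (j ν) * R : ℝ) : ℂ))
        = ((((n : ℝ) * (bump n ((j ν : ℕ) + 1) - bump n (j ν)) * R : ℝ)) : ℂ) := by
      push_cast; ring
    rw [e, norm_smul, Complex.norm_real, Real.norm_eq_abs, abs_mul, abs_of_nonneg hR0]
    have h1 := abs_bump_step_le n (j ν) h
    calc |(n : ℝ) * (bump n ((j ν : ℕ) + 1) - bump n (j ν))| * R * ‖φ y‖ ≤ 1 * 1 * ‖φ y‖ :=
          mul_le_mul_of_nonneg_right (mul_le_mul h1 hR1 hR0 zero_le_one) (norm_nonneg _)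
      _ ≤ ‖φ y‖ + ‖φ (y + unitVec M ν)‖ := by rw [mul_one, one_mul]; linarith [norm_nonneg (φ (y + unitVec M ν))]
  · -- across a face
    have heq : (j ν : ℕ) + 1 = n := by have := (j ν).is_lt; omega
    have hW' : bumpW n (Function.update j ν 0) = bump n ((0 : Fin n) : ℕ) * R := (bumpW_update n j ν 0).1
    have hb := bump_face n (j ν) heq
    rw [bpt_add_unitVec_of_eq n M y j ν heq, trialv_bpt, trialv_bpt, hW', hW, Fin.val_zero, hb.1, hb.2]
    have hn' : (n : ℂ) ≠ 0 := by exact_mod_cast NeZero.ne n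
    have e : (n : ℂ) • ((((1 / (n : ℝ) * R : ℝ)) : ℂ) • φ (y + unitVec M ν) - (((1 / (n : ℝ) * R : ℝ)) : ℂ) • φ y)
        = ((R : ℝ) : ℂ) • (φ (y + unitVec M ν) - φ y) := by
      rw [← smul_sub, smul_smul]
      congr 1
      push_cast; field_simp
    rw [e, norm_smul, Complex.norm_real, Real.norm_of_nonneg hR0]
    calc R * ‖φ (y + unitVec M ν) - φ y‖ ≤ 1 * (‖φ (y + unitVec M ν)‖ + ‖φ y‖) :=
          mul_le_mul hR1 (norm_sub_le _ _) (norm_nonneg _) zero_le_one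
      _ = ‖φ y‖ + ‖φ (y + unitVec M ν)‖ := by ring

/-! ## §3 Transports with a contractive right inverse: the covariant difference of `S·g` splits -/

omit [NeZero n] hM in
/-- the covariant difference of `x ↦ S(x)(g x)` splits into the plain difference of `g` and the transport DEFECT acting on `S(x)(g x′)`:
`R(S(x′)(g x′)) − S(x)(g x) = S(x)(g x′ − g x) + (R∘S(x′)∘T(x) − 1)(S(x)(g x′))` whenever `T(x)∘S(x) = 1` — no commutativity is used. [folklore] -/
theorem cov_diff_split {T S : Tor (fine n M) → (E →L[ℂ] E)} (hTS : ∀ x v, T x (S x v) = v) (R : E →L[ℂ] E) (g : Tor (fine n M) → E)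
    (x x' : Tor (fine n M)) :
    R (S x' (g x')) - S x (g x) = S x (g x' - g x) + (R * S x' * T x - 1) (S x (g x')) := by
  simp only [map_sub, sub_apply, mul_apply_eq_comp, hTS, one_apply_eq_self, sub_add_sub_cancel']

omit [NeZero n] hM in
/-- norm form of the split for CONTRACTIVE `S`: `‖R(λ(x′)) − λ(x)‖ ≤ ‖g x′ − g x‖ + ‖R∘S(x′)∘T(x) − 1‖·‖g x′‖`. [folklore] -/
theorem norm_cov_diff_le {T S : Tor (fine n M) → (E →L[ℂ] E)} (hTS : ∀ x v, T x (S x v) = v) (hS : ∀ x, ‖S x‖ ≤ 1) (R : E →L[ℂ] E)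
    (g : Tor (fine n M) → E) (x x' : Tor (fine n M)) :
    ‖R (S x' (g x')) - S x (g x)‖ ≤ ‖g x' - g x‖ + ‖R * S x' * T x - 1‖ * ‖g x'‖ := by
  rw [cov_diff_split n M hTS]
  refine (norm_add_le _ _).trans (add_le_add ?_ ?_)
  · exact (ContinuousLinearMap.le_of_opNorm_le _ (hS x) _).trans (by rw [one_mul])
  · refine (ContinuousLinearMap.le_opNorm _ _).trans (mul_le_mul_of_nonneg_left ?_ (norm_nonneg _))
    exact (ContinuousLinearMap.le_of_opNorm_le _ (hS x) _).trans (by rw [one_mul])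

omit [NeZero n] hM in
/-- the defect is at most `2` for contractive data: `‖R∘S(x′)∘T(x) − 1‖ ≤ ‖R‖‖S(x′)‖‖T(x)‖ + ‖1‖ ≤ 2`. [folklore] -/
theorem norm_defect_le_two {T S : Tor (fine n M) → (E →L[ℂ] E)} (hT : ∀ x, ‖T x‖ ≤ 1) (hS : ∀ x, ‖S x‖ ≤ 1) {R : E →L[ℂ] E} (hR : ‖R‖ ≤ 1)
    (x x' : Tor (fine n M)) : ‖R * S x' * T x - 1‖ ≤ 2 := by
  refine (norm_sub_le _ _).trans ?_
  have h1 : ‖R * S x' * T x‖ ≤ 1 := by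
    refine (norm_mul_le _ _).trans ?_
    have h2 : ‖R * S x'‖ ≤ 1 := (norm_mul_le _ _).trans (by nlinarith [hR, hS x', norm_nonneg R, norm_nonneg (S x')])
    nlinarith [hT x, norm_nonneg (R * S x'), norm_nonneg (T x)]
  have h3 : ‖(1 : E →L[ℂ] E)‖ ≤ 1 := ContinuousLinearMap.norm_id_le
  linarith

/-! ## §4 The competitor `λ_φ(x) = S(x)((β₁^d)⁻¹ • ψ_φ(x))` meets the transported constraint EXACTLY -/

/-- **THE COMPETITOR** `λ_φ(x) := S(x)((β₁^d)⁻¹ • ψ_φ(x))` — the in-block trial field pulled back by the right inverses of the site transports. [folklore] -/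
def comp (S : Tor (fine n M) → (E →L[ℂ] E)) (φ : Tor M → E) : Tor (fine n M) → E :=
  fun x => S x (((((beta1 n) ^ d)⁻¹ : ℝ) : ℂ) • trialv n M φ x)

/-- **CONSTRAINT, EXACTLY**: `Q_T λ_φ = φ` when `T(x)∘S(x) = 1` — the transports cancel and the trial field has block sums `(nβ₁)^d • φ`. [folklore] -/
theorem Qcv_comp {T S : Tor (fine n M) → (E →L[ℂ] E)} (hTS : ∀ x v, T x (S x v) = v) (φ : Tor M → E) :
    Qcv n M T (comp n M S φ) = φ := by
  have hβ : (beta1 n) ^ d ≠ 0 := (pow_pos (beta1_ge n).2 d).ne'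
  have hn : (n : ℂ) ≠ 0 := by exact_mod_cast NeZero.ne n
  funext z
  unfold Qcv comp
  simp_rw [hTS]
  rw [← Finset.smul_sum, sum_trialv_eq, smul_smul, smul_smul]
  have e : ((n : ℂ) ^ d)⁻¹ * (((((beta1 n) ^ d)⁻¹ : ℝ) : ℂ)) * ((((n : ℝ) * beta1 n) ^ d : ℝ) : ℂ) = 1 := by
    have hβc : ((beta1 n : ℝ) : ℂ) ≠ 0 := by exact_mod_cast (beta1_ge n).2.ne'
    push_cast
    rw [mul_pow]
    field_simp
  rw [e, one_smul]

/-! ## §5 The bond-wise bound: in-block bonds by the defect `w`, face bonds by the face values `‖φ‖/n` -/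

/-- **BOND-WISE BOUND** at `x = n·y + j`, direction `μ`: `‖R(x,μ)(λ_φ(x+e_μ)) − λ_φ(x)‖ ≤ (c/n)·((1 + n·w)·‖φ(y)‖ + 3·‖φ(y+e_μ)‖)`, `c = (β₁^d)⁻¹` —
in-block bonds pay the defect `w` on `‖ψ_φ‖ ≤ ‖φ(y)‖`, face bonds pay the trivial defect `2` on the face value `‖φ(y+e_μ)‖/n`. [folklore] -/
theorem norm_bond_le {T S : Tor (fine n M) → (E →L[ℂ] E)} (hTS : ∀ x v, T x (S x v) = v) (hT : ∀ x, ‖T x‖ ≤ 1) (hS : ∀ x, ‖S x‖ ≤ 1)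
    {R : Tor (fine n M) → Fin d → (E →L[ℂ] E)} (hR : ∀ x μ, ‖R x μ‖ ≤ 1) {w : ℝ} (hw0 : 0 ≤ w)
    (hw : ∀ (y : Tor M) (j : Fin d → Fin n) (μ : Fin d), (j μ : ℕ) + 1 < n →
      ‖R (bpt n M y j) μ * S (bpt n M y j + unitVec (fine n M) μ) * T (bpt n M y j) - 1‖ ≤ w)
    (φ : Tor M → E) (y : Tor M) (j : Fin d → Fin n) (μ : Fin d) :
    ‖R (bpt n M y j) μ (comp n M S φ (bpt n M y j + unitVec (fine n M) μ)) - comp n M S φ (bpt n M y j)‖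
      ≤ ((beta1 n) ^ d)⁻¹ / n * ((1 + n * w) * ‖φ y‖ + 3 * ‖φ (y + unitVec M μ)‖) := by
  set c : ℝ := ((beta1 n) ^ d)⁻¹ with hc
  obtain ⟨hc0, -⟩ := inv_beta_pow_mem n (d := d)
  have hn0 : (0 : ℝ) < n := by exact_mod_cast Nat.pos_of_ne_zero (NeZero.ne n)
  have hn' : (n : ℝ) ≠ 0 := hn0.ne'
  have hsplit := norm_cov_diff_le n M hTS hS (R (bpt n M y j) μ) (fun z => ((c : ℝ) : ℂ) • trialv n M φ z)
    (bpt n M y j) (bpt n M y j + unitVec (fine n M) μ)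
  unfold comp
  beta_reduce at hsplit
  -- the plain difference: the one-step bound, divided by `n`
  have hstep : ‖((c : ℝ) : ℂ) • trialv n M φ (bpt n M y j + unitVec (fine n M) μ) - ((c : ℝ) : ℂ) • trialv n M φ (bpt n M y j)‖
      ≤ c / n * (‖φ y‖ + ‖φ (y + unitVec M μ)‖) := by
    have h := norm_step_trialv_le n M φ y j μ
    rw [norm_smul, Complex.norm_natCast] at h
    have h' : ‖trialv n M φ (bpt n M y j + unitVec (fine n M) μ) - trialv n M φ (bpt n M y j)‖
        ≤ (‖φ y‖ + ‖φ (y + unitVec M μ)‖) / n := by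
      rw [le_div_iff₀ hn0, mul_comm]; exact h
    rw [← smul_sub, norm_smul, Complex.norm_real, Real.norm_of_nonneg hc0.le]
    calc c * ‖trialv n M φ (bpt n M y j + unitVec (fine n M) μ) - trialv n M φ (bpt n M y j)‖
        ≤ c * ((‖φ y‖ + ‖φ (y + unitVec M μ)‖) / n) := mul_le_mul_of_nonneg_left h' hc0.le
      _ = c / n * (‖φ y‖ + ‖φ (y + unitVec M μ)‖) := by ring
  have hφ0 : 0 ≤ ‖φ y‖ := norm_nonneg _
  have hφ1 : 0 ≤ ‖φ (y + unitVec M μ)‖ := norm_nonneg _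
  by_cases hlt : (j μ : ℕ) + 1 < n
  · -- IN-BLOCK bond: defect ≤ w, value ≤ c‖φ y‖
    have hv := hw y j μ hlt
    have hgx' : ‖((c : ℝ) : ℂ) • trialv n M φ (bpt n M y j + unitVec (fine n M) μ)‖ ≤ c * ‖φ y‖ := by
      rw [bpt_add_unitVec_of_lt n M y j μ hlt, norm_smul, Complex.norm_real, Real.norm_of_nonneg hc0.le]
      exact mul_le_mul_of_nonneg_left (norm_trialv_le n M φ y _ μ).1 hc0.le
    calc _ ≤ _ := hsplit
      _ ≤ c / n * (‖φ y‖ + ‖φ (y + unitVec M μ)‖) + w * (c * ‖φ y‖) :=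
          add_le_add hstep (mul_le_mul hv hgx' (norm_nonneg _) hw0)
      _ = c / n * ((1 + n * w) * ‖φ y‖ + ‖φ (y + unitVec M μ)‖) := by field_simp; ring
      _ ≤ c / n * ((1 + n * w) * ‖φ y‖ + 3 * ‖φ (y + unitVec M μ)‖) := by
          refine mul_le_mul_of_nonneg_left ?_ (by positivity); linarith
  · -- FACE bond: defect ≤ 2, value ≤ c‖φ(y+e_μ)‖/n
    have heq : (j μ : ℕ) + 1 = n := by have := (j μ).is_lt; omega
    have hv : ‖R (bpt n M y j) μ * S (bpt n M y j + unitVec (fine n M) μ) * T (bpt n M y j) - 1‖ ≤ 2 :=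
      norm_defect_le_two n M hT hS (hR _ μ) _ _
    have hgx' : ‖((c : ℝ) : ℂ) • trialv n M φ (bpt n M y j + unitVec (fine n M) μ)‖ ≤ c * (‖φ (y + unitVec M μ)‖ / n) := by
      rw [bpt_add_unitVec_of_eq n M y j μ heq, norm_smul, Complex.norm_real, Real.norm_of_nonneg hc0.le]
      exact mul_le_mul_of_nonneg_left (norm_trialv_le n M φ (y + unitVec M μ) j μ).2 hc0.le
    have hnw : 0 ≤ n * w := by positivity
    calc _ ≤ _ := hsplit
      _ ≤ c / n * (‖φ y‖ + ‖φ (y + unitVec M μ)‖) + 2 * (c * (‖φ (y + unitVec M μ)‖ / n)) :=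
          add_le_add hstep (mul_le_mul hv hgx' (norm_nonneg _) (by norm_num))
      _ = c / n * (‖φ y‖ + 3 * ‖φ (y + unitVec M μ)‖) := by field_simp; ring
      _ ≤ c / n * ((1 + n * w) * ‖φ y‖ + 3 * ‖φ (y + unitVec M μ)‖) := by
          refine mul_le_mul_of_nonneg_left ?_ (by positivity); nlinarith

/-! ## §6 Summing over blocks, base points and directions -/

/-- **LEAF V-COL-UB (lattice units)**: `n²·Σ_μ dirUv R λ_φ μ ≤ 2d·(β₁^d)⁻²·((1 + n w)² + 9)·(n^d·Σ_y‖φ y‖²)`. [folklore] -/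
theorem sq_mul_dirUv_comp_le {T S : Tor (fine n M) → (E →L[ℂ] E)} (hTS : ∀ x v, T x (S x v) = v) (hT : ∀ x, ‖T x‖ ≤ 1)
    (hS : ∀ x, ‖S x‖ ≤ 1) {R : Tor (fine n M) → Fin d → (E →L[ℂ] E)} (hR : ∀ x μ, ‖R x μ‖ ≤ 1) {w : ℝ} (hw0 : 0 ≤ w)
    (hw : ∀ (y : Tor M) (j : Fin d → Fin n) (μ : Fin d), (j μ : ℕ) + 1 < n →
      ‖R (bpt n M y j) μ * S (bpt n M y j + unitVec (fine n M) μ) * T (bpt n M y j) - 1‖ ≤ w)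
    (φ : Tor M → E) :
    (n : ℝ) ^ 2 * ∑ μ, dirUv (fine n M) R (comp n M S φ) μ ≤ 2 * d * (((beta1 n) ^ d)⁻¹) ^ 2 * ((1 + n * w) ^ 2 + 9) * ((n : ℝ) ^ d * nsqv φ) := by
  set c : ℝ := ((beta1 n) ^ d)⁻¹ with hc
  have hn0 : (0 : ℝ) < n := by exact_mod_cast Nat.pos_of_ne_zero (NeZero.ne n)
  have hcard : (Fintype.card (Fin d → Fin n) : ℝ) = (n : ℝ) ^ d := by
    rw [Fintype.card_fun, Fintype.card_fin, Fintype.card_fin]; push_cast; ring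
  have hshift : ∀ μ : Fin d, ∑ y : Tor M, ‖φ (y + unitVec M μ)‖ ^ 2 = nsqv φ := fun μ =>
    Fintype.sum_equiv (Equiv.addRight (unitVec M μ)) _ _ fun y => rfl
  -- per direction
  have hμ : ∀ μ : Fin d, (n : ℝ) ^ 2 * ∑ x, ‖R x μ (comp n M S φ (x + unitVec (fine n M) μ)) - comp n M S φ x‖ ^ 2
      ≤ 2 * c ^ 2 * ((1 + n * w) ^ 2 + 9) * ((n : ℝ) ^ d * nsqv φ) := by
    intro μ
    rw [sum_blocks_real n M (fun x => ‖R x μ (comp n M S φ (x + unitVec (fine n M) μ)) - comp n M S φ x‖ ^ 2)]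
    have hpt : ∀ (y : Tor M) (j : Fin d → Fin n),
        (n : ℝ) ^ 2 * ‖R (bpt n M y j) μ (comp n M S φ (bpt n M y j + unitVec (fine n M) μ)) - comp n M S φ (bpt n M y j)‖ ^ 2
          ≤ 2 * c ^ 2 * ((1 + n * w) ^ 2 * ‖φ y‖ ^ 2 + 9 * ‖φ (y + unitVec M μ)‖ ^ 2) := by
      intro y j
      have h := norm_bond_le n M hTS hT hS hR hw0 hw φ y j μ
      have h2 := pow_le_pow_left₀ (norm_nonneg _) h 2
      have e : (n : ℝ) ^ 2 * (c / n * ((1 + n * w) * ‖φ y‖ + 3 * ‖φ (y + unitVec M μ)‖)) ^ 2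
          = c ^ 2 * ((1 + n * w) * ‖φ y‖ + 3 * ‖φ (y + unitVec M μ)‖) ^ 2 := by
        field_simp
      have h3 : ((1 + n * w) * ‖φ y‖ + 3 * ‖φ (y + unitVec M μ)‖) ^ 2
          ≤ 2 * ((1 + n * w) ^ 2 * ‖φ y‖ ^ 2 + 9 * ‖φ (y + unitVec M μ)‖ ^ 2) := by
        nlinarith [sq_nonneg ((1 + n * w) * ‖φ y‖ - 3 * ‖φ (y + unitVec M μ)‖)]
      calc _ ≤ (n : ℝ) ^ 2 * (c / n * ((1 + n * w) * ‖φ y‖ + 3 * ‖φ (y + unitVec M μ)‖)) ^ 2 :=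
            mul_le_mul_of_nonneg_left h2 (by positivity)
        _ = c ^ 2 * ((1 + n * w) * ‖φ y‖ + 3 * ‖φ (y + unitVec M μ)‖) ^ 2 := e
        _ ≤ _ := by nlinarith [h3, sq_nonneg c]
    rw [mul_sum]
    calc ∑ y : Tor M, (n : ℝ) ^ 2 * ∑ j : Fin d → Fin n,
          ‖R (bpt n M y j) μ (comp n M S φ (bpt n M y j + unitVec (fine n M) μ)) - comp n M S φ (bpt n M y j)‖ ^ 2
        ≤ ∑ y : Tor M, ∑ _j : Fin d → Fin n, 2 * c ^ 2 * ((1 + n * w) ^ 2 * ‖φ y‖ ^ 2 + 9 * ‖φ (y + unitVec M μ)‖ ^ 2) := by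
          refine sum_le_sum fun y _ => ?_
          rw [mul_sum]
          exact sum_le_sum fun j _ => hpt y j
      _ = ∑ y : Tor M, ((n : ℝ) ^ d * (2 * c ^ 2 * (1 + n * w) ^ 2) * ‖φ y‖ ^ 2
            + (n : ℝ) ^ d * (2 * c ^ 2 * 9) * ‖φ (y + unitVec M μ)‖ ^ 2) := by
          simp only [sum_const, card_univ, nsmul_eq_mul, hcard]
          exact sum_congr rfl fun y _ => by ring
      _ = 2 * c ^ 2 * ((1 + n * w) ^ 2 + 9) * ((n : ℝ) ^ d * nsqv φ) := by
          rw [sum_add_distrib, ← mul_sum, ← mul_sum, hshift μ]; unfold nsqv; ring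
  unfold dirUv cDv
  rw [mul_sum]
  calc _ ≤ ∑ _μ : Fin d, 2 * c ^ 2 * ((1 + n * w) ^ 2 + 9) * ((n : ℝ) ^ d * nsqv φ) := sum_le_sum fun μ _ => hμ μ
    _ = 2 * d * c ^ 2 * ((1 + n * w) ^ 2 + 9) * ((n : ℝ) ^ d * nsqv φ) := by
        rw [sum_const, card_univ, Fintype.card_fin, nsmul_eq_mul]; ring

/-- **LEAF V-COL-UB (physical units, explicit constant)**: `n^{2−d}·Σ_μ dirUv R λ_φ μ ≤ 2d·36^d·((1 + n w)² + 9)·Σ_y‖φ y‖²` — the covariant Dirichlet ACTION of the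
competitor in the normalisation `Sc(λ) = n^{2−d}Σ‖D_Rλ‖²` ([B9] (3.23) prefactor `(L^jη)^{d−2}`, `L^jη = n⁻¹`; SHAPE only) against the unit-lattice `ℓ²` size of `φ`;
the SAME constant as the scalar leaf UB⁺. [folklore] -/
theorem physDirv_comp_le {T S : Tor (fine n M) → (E →L[ℂ] E)} (hTS : ∀ x v, T x (S x v) = v) (hT : ∀ x, ‖T x‖ ≤ 1)
    (hS : ∀ x, ‖S x‖ ≤ 1) {R : Tor (fine n M) → Fin d → (E →L[ℂ] E)} (hR : ∀ x μ, ‖R x μ‖ ≤ 1) {w : ℝ} (hw0 : 0 ≤ w)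
    (hw : ∀ (y : Tor M) (j : Fin d → Fin n) (μ : Fin d), (j μ : ℕ) + 1 < n →
      ‖R (bpt n M y j) μ * S (bpt n M y j + unitVec (fine n M) μ) * T (bpt n M y j) - 1‖ ≤ w)
    (φ : Tor M → E) :
    ((n : ℝ) ^ d)⁻¹ * ((n : ℝ) ^ 2 * ∑ μ, dirUv (fine n M) R (comp n M S φ) μ) ≤ 2 * d * (36 : ℝ) ^ d * ((1 + n * w) ^ 2 + 9) * nsqv φ := by
  have hn0 : (0 : ℝ) < (n : ℝ) ^ d := by have := NeZero.ne n; positivity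
  have h := sq_mul_dirUv_comp_le n M hTS hT hS hR hw0 hw φ
  obtain ⟨hc0, hc6⟩ := inv_beta_pow_mem n (d := d)
  have hc2 : (((beta1 n) ^ d)⁻¹) ^ 2 ≤ (36 : ℝ) ^ d := by
    calc (((beta1 n) ^ d)⁻¹) ^ 2 ≤ ((6 : ℝ) ^ d) ^ 2 := pow_le_pow_left₀ hc0.le hc6 2
      _ = (36 : ℝ) ^ d := by rw [← pow_mul, mul_comm, pow_mul]; norm_num
  have hφ := nsqv_nonneg φ
  rw [inv_mul_le_iff₀ hn0]
  calc _ ≤ 2 * d * (((beta1 n) ^ d)⁻¹) ^ 2 * ((1 + n * w) ^ 2 + 9) * ((n : ℝ) ^ d * nsqv φ) := h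
    _ ≤ 2 * d * (36 : ℝ) ^ d * ((1 + n * w) ^ 2 + 9) * ((n : ℝ) ^ d * nsqv φ) := by gcongr
    _ = _ := by ring

/-! ## §7 The V-COL-UB reading for the block-spin value (P2's `VariationalTransfer.blockSpin`, type-generic) and the `∃`-forms -/

/-- **LEAF V-COL-UB (block-spin reading)**: the covariant effective action of the `E`-valued layer, `Δ′(φ) = inf {Sc(λ) : Q_T λ = φ}`,
`Sc(λ) = n^{2−d}Σ_{μ,x}‖R(x,μ)(λ(x+e_μ)) − λ(x)‖²`, obeys `Δ′(φ) ≤ 2d·36^d·((1 + n·w)² + 9)·Σ_y‖φ(y)‖²` — k-UNIFORM (the level enters only through `n·w`), every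
torus, every normed ℂ-space `E`, under contractive transports with contractive right-inverse site transports and the IN-BLOCK defect `w`; no global frame. [folklore] -/
theorem blockSpin_colour_le {T S : Tor (fine n M) → (E →L[ℂ] E)} (hTS : ∀ x v, T x (S x v) = v) (hT : ∀ x, ‖T x‖ ≤ 1)
    (hS : ∀ x, ‖S x‖ ≤ 1) {R : Tor (fine n M) → Fin d → (E →L[ℂ] E)} (hR : ∀ x μ, ‖R x μ‖ ≤ 1) {w : ℝ} (hw0 : 0 ≤ w)
    (hw : ∀ (y : Tor M) (j : Fin d → Fin n) (μ : Fin d), (j μ : ℕ) + 1 < n →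
      ‖R (bpt n M y j) μ * S (bpt n M y j + unitVec (fine n M) μ) * T (bpt n M y j) - 1‖ ≤ w)
    (φ : Tor M → E) :
    blockSpin (Qcv n M T) (fun f => ((n : ℝ) ^ d)⁻¹ * ((n : ℝ) ^ 2 * ∑ μ, dirUv (fine n M) R f μ)) φ
      ≤ 2 * d * (36 : ℝ) ^ d * ((1 + n * w) ^ 2 + 9) * nsqv φ := by
  have hSn : ∀ f : Tor (fine n M) → E, 0 ≤ ((n : ℝ) ^ d)⁻¹ * ((n : ℝ) ^ 2 * ∑ μ, dirUv (fine n M) R f μ) := fun f => by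
    have : 0 ≤ ∑ μ, dirUv (fine n M) R f μ := sum_nonneg fun μ _ => dirUv_nonneg _ R f μ
    positivity
  exact (blockSpin_le hSn (Qcv_comp n M hTS φ)).trans (physDirv_comp_le n M hTS hT hS hR hw0 hw φ)

/-- **LEAF V-COL-UB, `∃`-form, physical units** (`Λ := 2d·36^d·((1 + n·w)² + 9)`): `∃ f, Qcv T f = φ ∧ n^{−d}·(n²·Σ_μ dirUv R f μ) ≤ Λ·Σ‖φ‖²` — the shape of
an upper-bound binder `hUBc` for a vector∕colour assembly in the letters `Qcv`, `dirUv`, `nsqv`. [folklore] -/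
theorem exists_ubv_phys {T S : Tor (fine n M) → (E →L[ℂ] E)} (hTS : ∀ x v, T x (S x v) = v) (hT : ∀ x, ‖T x‖ ≤ 1)
    (hS : ∀ x, ‖S x‖ ≤ 1) {R : Tor (fine n M) → Fin d → (E →L[ℂ] E)} (hR : ∀ x μ, ‖R x μ‖ ≤ 1) {w : ℝ} (hw0 : 0 ≤ w)
    (hw : ∀ (y : Tor M) (j : Fin d → Fin n) (μ : Fin d), (j μ : ℕ) + 1 < n →
      ‖R (bpt n M y j) μ * S (bpt n M y j + unitVec (fine n M) μ) * T (bpt n M y j) - 1‖ ≤ w) :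
    ∀ φ : Tor M → E, ∃ f : Tor (fine n M) → E, Qcv n M T f = φ ∧
      ((n : ℝ) ^ d)⁻¹ * ((n : ℝ) ^ 2 * ∑ μ, dirUv (fine n M) R f μ) ≤ 2 * d * (36 : ℝ) ^ d * ((1 + n * w) ^ 2 + 9) * nsqv φ :=
  fun φ => ⟨_, Qcv_comp n M hTS φ, physDirv_comp_le n M hTS hT hS hR hw0 hw φ⟩

end Summit.QuantumFields.BalabanUV.T4Continuum.VariationalColourUpperBound

end
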